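import Mathlib
import Summits.Ventures.PercRepro2.Defs
import Summits.Ventures.PercRepro2.Harris
import Summits.Ventures.PercRepro2.Graph
import Summits.Ventures.PercRepro2.Events
import Summits.Ventures.PercRepro2.THRefutation

/-!
# Transport of the three-event form along subgraph embeddings, and the refutation of (T_h) on every
graph containing the 7-vertex witness (blind cell PercRepro2, mine-a g49)

Two transport lemmas for cluster events: (1) **edge extension** — for an injection `ιE : E ↪ E'` of edge
types with `ends' ∘ ιE = ends`, giving the new edges weight `0` (`extP`), every probability of a cluster
event of `ends'` equals the probability of the corresponding event of `ends` (`prob_extP`); (2) **vertex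
extension** — for an injection `ιV : V ↪ V'` with `ends' = Sym2.map ιV ∘ ends`, the cluster of `ιV x` is
the image of the cluster of `x` (`cluster_map`), so the cluster event of the lifted family
`liftFam ιV 𝓤 = {S' | ιV ⁻¹' S' ∈ 𝓤}` (an up-set when `𝓤` is) is the cluster event of `𝓤`
(`clusterInEvent_map`).  Hence the three-event form is invariant under subgraph embeddings
(`t_form_extend`), and **(T_h) fails on every finite graph containing the class-(vi) graph `G₆` of
`THRefutation` as a subgraph**, in particular on `K_n` for `n ≥ 7` (`not_t_of_subgraph`): the class of
graphs satisfying `(T_h)` is closed under subgraphs and `G₆` is one of its excluded subgraphs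
(MINE-A.md §104).  No instance, no notation.
-/

namespace Summit.Ventures.PercRepro2

namespace THExtension

open Finset

section EdgeExtension

variable {V : Type*} {E E' : Type*} {R : Type*} [CommRing R]

/-- Weights extended by `0` on the new edges. -/
noncomputable def extP (ιE : E ↪ E') (p : E → R) : E' → R := Function.extend ιE p 0

/-- A configuration extended by `closed` on the new edges. -/
noncomputable def extC (ιE : E ↪ E') (ω : Config E) : Config E' :=
  Function.extend ιE ω (fun _ => false)

/-- `extP` on an old edge. -/
lemma extP_apply (ιE : E ↪ E') (p : E → R) (e : E) : extP ιE p (ιE e) = p e :=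
  ιE.injective.extend_apply _ _ _

/-- `extP` on a new edge. -/
lemma extP_apply' (ιE : E ↪ E') (p : E → R) {e' : E'} (h : ¬ ∃ e, ιE e = e') :
    extP ιE p e' = 0 :=
  Function.extend_apply' _ _ _ h

/-- `extC` on an old edge. -/
lemma extC_apply (ιE : E ↪ E') (ω : Config E) (e : E) : extC ιE ω (ιE e) = ω e :=
  ιE.injective.extend_apply _ _ _

/-- `extC` on a new edge. -/
lemma extC_apply' (ιE : E ↪ E') (ω : Config E) {e' : E'} (h : ¬ ∃ e, ιE e = e') :
    extC ιE ω e' = false :=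
  Function.extend_apply' _ _ _ h

/-- `extC` is injective. -/
lemma extC_injective (ιE : E ↪ E') : Function.Injective (extC ιE) := by
  intro ω₁ ω₂ h
  funext e
  have := congrFun h (ιE e)
  rwa [extC_apply, extC_apply] at this

/-- Extended weights are admissible. -/
lemma isProbVec_extP [PartialOrder R] [IsOrderedRing R] (ιE : E ↪ E') {p : E → R}
    (hp : IsProbVec p) : IsProbVec (extP ιE p) := by
  refine ⟨fun e' => ?_, fun e' => ?_⟩
  · by_cases h : ∃ e, ιE e = e'
    · obtain ⟨e, rfl⟩ := h; rw [extP_apply]; exact hp.nonneg e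
    · rw [extP_apply' ιE p h]
  · by_cases h : ∃ e, ιE e = e'
    · obtain ⟨e, rfl⟩ := h; rw [extP_apply]; exact hp.le_one e
    · rw [extP_apply' ιE p h]; exact zero_le_one

/-- A configuration closed on every new edge is an extended configuration. -/
lemma eq_extC_of_closed (ιE : E ↪ E') {ω' : Config E'}
    (h : ∀ e', (¬ ∃ e, ιE e = e') → ω' e' = false) : ω' = extC ιE (fun e => ω' (ιE e)) := by
  funext e'
  by_cases he : ∃ e, ιE e = e'
  · obtain ⟨e, rfl⟩ := he; rw [extC_apply]
  · rw [extC_apply' ιE _ he, h e' he]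

/-- The open graph of an extended configuration is the old open graph (`ends' ∘ ιE = ends`). -/
lemma openGraph_extC (ιE : E ↪ E') (ends : E → Sym2 V) (ends' : E' → Sym2 V)
    (h : ∀ e, ends' (ιE e) = ends e) (ω : Config E) :
    openGraph ends' (extC ιE ω) = openGraph ends ω := by
  ext u v
  rw [openGraph_adj, openGraph_adj]
  refine and_congr_right fun _ => ⟨?_, ?_⟩
  · rintro ⟨e', he', hends⟩
    by_cases hr : ∃ e, ιE e = e'
    · obtain ⟨e, rfl⟩ := hr
      exact ⟨e, by rwa [extC_apply] at he', by rwa [h] at hends⟩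
    · rw [extC_apply' ιE ω hr] at he'; exact absurd he' Bool.false_ne_true
  · rintro ⟨e, he, hends⟩
    exact ⟨ιE e, by rwa [extC_apply], by rwa [h]⟩

/-- Clusters of an extended configuration are the old clusters. -/
lemma cluster_extC (ιE : E ↪ E') (ends : E → Sym2 V) (ends' : E' → Sym2 V)
    (h : ∀ e, ends' (ιE e) = ends e) (ω : Config E) (x : V) :
    cluster ends' (extC ιE ω) x = cluster ends ω x := by
  ext u
  simp only [mem_cluster, Conn, openGraph_extC ιE ends ends' h]

/-- The preimage of a cluster event under `extC` is the old cluster event. -/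
lemma preimage_clusterInEvent (ιE : E ↪ E') (ends : E → Sym2 V) (ends' : E' → Sym2 V)
    (h : ∀ e, ends' (ιE e) = ends e) (x : V) (𝓔 : Set (Set V)) :
    extC ιE ⁻¹' clusterInEvent ends' x 𝓔 = clusterInEvent ends x 𝓔 := by
  ext ω
  simp only [Set.mem_preimage, mem_clusterInEvent, cluster_extC ιE ends ends' h]

variable [Fintype E']

/-- A configuration open on a new edge has weight `0`. -/
lemma weight_eq_zero_of_new (ιE : E ↪ E') (p : E → R) {ω' : Config E'} {e' : E'}
    (h : ¬ ∃ e, ιE e = e') (hω : ω' e' = true) : weight (extP ιE p) ω' = 0 := by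
  unfold weight
  refine prod_eq_zero (mem_univ e') ?_
  rw [extP_apply' ιE p h, hω]
  simp

variable [Fintype E] [DecidableEq E']

/-- The weight of an extended configuration is the old weight. -/
lemma weight_extC (ιE : E ↪ E') (p : E → R) (ω : Config E) :
    weight (extP ιE p) (extC ιE ω) = weight p ω := by
  unfold weight
  rw [← prod_mul_prod_compl (univ.map ιE)]
  have h1 : ∏ e' ∈ (univ.map ιE)ᶜ, edgeFactor (extP ιE p e') (extC ιE ω e') = 1 := by
    refine prod_eq_one fun e' he' => ?_
    have h : ¬ ∃ e, ιE e = e' := by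
      rintro ⟨e, rfl⟩
      exact (mem_compl.1 he') (mem_map_of_mem _ (mem_univ e))
    rw [extP_apply' ιE p h, extC_apply' ιE ω h]
    simp
  rw [h1, mul_one, prod_map]
  exact prod_congr rfl fun e _ => by simp only [extP_apply, extC_apply]

variable [DecidableEq E]

/-- **Transport of probabilities along an edge extension**: with the new edges at weight `0`,
`P(A') = P(extC ⁻¹' A')`. -/
theorem prob_extP (ιE : E ↪ E') (p : E → R) (A' : Set (Config E')) :
    prob (extP ιE p) A' = prob p (extC ιE ⁻¹' A') := by
  classical
  unfold prob
  have hsub : (univ : Finset (Config E)).map ⟨extC ιE, extC_injective ιE⟩ ⊆ univ :=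
    subset_univ _
  rw [← sum_subset hsub, sum_map]
  · refine sum_congr rfl fun ω _ => ?_
    by_cases h : extC ιE ω ∈ A' <;> simp [h, Set.mem_preimage, weight_extC]
  · intro ω' _ hω'
    by_contra hne
    apply hω'
    rw [mem_map]
    refine ⟨fun e => ω' (ιE e), mem_univ _, ?_⟩
    simp only [Function.Embedding.coeFn_mk]
    refine (eq_extC_of_closed ιE fun e' he' => ?_).symm
    by_contra hopen
    have hopen' : ω' e' = true := by simpa using hopen
    exact hne (by rw [Set.indicator_apply]; split_ifs <;>
      simp [weight_eq_zero_of_new ιE p he' hopen'])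

end EdgeExtension

section VertexExtension

variable {V V' : Type*} {E : Type*}

/-- The edge map pushed forward along a vertex injection. -/
def mapEnds (ιV : V ↪ V') (ends : E → Sym2 V) : E → Sym2 V' := fun e => (ends e).map ιV

/-- A family of vertex sets lifted along a vertex injection. -/
def liftFam (ιV : V ↪ V') (𝓤 : Set (Set V)) : Set (Set V') := {S' | ιV ⁻¹' S' ∈ 𝓤}

/-- Lifting preserves up-sets. -/
lemma isUpperSet_liftFam (ιV : V ↪ V') {𝓤 : Set (Set V)} (h : IsUpperSet 𝓤) :
    IsUpperSet (liftFam ιV 𝓤) :=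
  fun _ _ hle hS => h (Set.preimage_mono hle) hS

/-- The lift of a hit family `{T | x ∈ T}` is the hit family of `ιV x`. -/
lemma liftFam_hit (ιV : V ↪ V') (x : V) :
    liftFam ιV {T : Set V | x ∈ T} = {T : Set V' | ιV x ∈ T} := by
  ext S'; simp [liftFam]

/-- Open adjacency in the pushed-forward graph, between image vertices. -/
lemma openAdj_map_iff (ιV : V ↪ V') (ends : E → Sym2 V) (ω : Config E) (u v : V) :
    OpenAdj (mapEnds ιV ends) ω (ιV u) (ιV v) ↔ OpenAdj ends ω u v := by
  constructor
  · rintro ⟨e, he, hends⟩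
    refine ⟨e, he, ?_⟩
    apply Sym2.map.injective ιV.injective
    rw [Sym2.map_mk]
    exact hends
  · rintro ⟨e, he, hends⟩
    exact ⟨e, he, by simp [mapEnds, hends, Sym2.map_mk]⟩

/-- The pushed-forward open graph has no open edge leaving the image. -/
lemma openAdj_map_mem_range (ιV : V ↪ V') (ends : E → Sym2 V) (ω : Config E) (u : V) (w : V')
    (h : OpenAdj (mapEnds ιV ends) ω (ιV u) w) : ∃ v, w = ιV v := by
  obtain ⟨e, -, hends⟩ := h
  induction he : ends e using Sym2.ind with
  | h a b =>
    simp only [mapEnds, he, Sym2.map_mk, Sym2.eq_iff] at hends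
    rcases hends with ⟨-, h2⟩ | ⟨h1, -⟩
    · exact ⟨b, h2.symm⟩
    · exact ⟨a, h1.symm⟩

/-- **The cluster of an image vertex is the image of the cluster.** -/
theorem cluster_map (ιV : V ↪ V') (ends : E → Sym2 V) (ω : Config E) (x : V) :
    cluster (mapEnds ιV ends) ω (ιV x) = ιV '' cluster ends ω x := by
  apply Set.Subset.antisymm
  · intro w hw
    refine mem_of_conn_of_closed (ends := mapEnds ιV ends) (ω := ω) (S := ιV '' cluster ends ω x)
      ?_ ⟨x, mem_cluster_self ends ω x, rfl⟩ hw
    rintro _ ⟨u, hu, rfl⟩ w' hadj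
    obtain ⟨-, hadj'⟩ := openGraph_adj.1 hadj
    obtain ⟨v, rfl⟩ := openAdj_map_mem_range ιV ends ω u w' hadj'
    refine ⟨v, ?_, rfl⟩
    rw [mem_cluster] at hu ⊢
    exact conn_trans hu (conn_of_openAdj ((openAdj_map_iff ιV ends ω u v).1 hadj'))
  · rintro _ ⟨u, hu, rfl⟩
    rw [mem_cluster] at hu ⊢
    unfold Conn at hu ⊢
    rw [SimpleGraph.reachable_iff_reflTransGen] at hu ⊢
    induction hu with
    | refl => exact Relation.ReflTransGen.refl
    | tail _ hyz ih =>
      refine Relation.ReflTransGen.tail ih ?_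
      obtain ⟨hne, hadj⟩ := openGraph_adj.1 hyz
      exact openGraph_adj.2 ⟨fun h => hne (ιV.injective h), (openAdj_map_iff ιV ends ω _ _).2 hadj⟩

/-- The cluster event of a lifted family is the cluster event of the family. -/
theorem clusterInEvent_map (ιV : V ↪ V') (ends : E → Sym2 V) (x : V) (𝓤 : Set (Set V)) :
    clusterInEvent (mapEnds ιV ends) (ιV x) (liftFam ιV 𝓤) = clusterInEvent ends x 𝓤 := by
  ext ω
  simp only [mem_clusterInEvent, liftFam, Set.mem_setOf_eq, cluster_map,
    Set.preimage_image_eq _ ιV.injective]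

end VertexExtension

section Form

variable {V V' : Type*} {E E' : Type*} [Fintype E] [DecidableEq E] [Fintype E'] [DecidableEq E']
  {R : Type*} [CommRing R]

/-- The three-event form `P(Q ∩ U ∩ e) + P(Q) P(U ∩ e) − P(Q ∩ U) P(e) − P(Q ∩ e) P(U)` of the root
`s`, the hit vertex `h` and the families `𝓤 𝓥` (`Q = {h ∈ C_s}`, `U = {C_s ∈ 𝓤}`, `e = {C_s ∈ 𝓥}`);
`(T_h)` is the statement `0 ≤ tForm`. -/
noncomputable def tForm (ends : E → Sym2 V) (p : E → R) (s h : V) (𝓤 𝓥 : Set (Set V)) : R :=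
  prob p (clusterInEvent ends s {T : Set V | h ∈ T} ∩ clusterInEvent ends s 𝓤 ∩
      clusterInEvent ends s 𝓥)
    + prob p (clusterInEvent ends s {T : Set V | h ∈ T}) *
      prob p (clusterInEvent ends s 𝓤 ∩ clusterInEvent ends s 𝓥)
    - prob p (clusterInEvent ends s {T : Set V | h ∈ T} ∩ clusterInEvent ends s 𝓤) *
      prob p (clusterInEvent ends s 𝓥)
    - prob p (clusterInEvent ends s {T : Set V | h ∈ T} ∩ clusterInEvent ends s 𝓥) *
      prob p (clusterInEvent ends s 𝓤)

/-- **The form is invariant under an edge extension** (new edges at weight `0`). -/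
theorem tForm_extE (ιE : E ↪ E') (ends : E → Sym2 V) (ends' : E' → Sym2 V)
    (h : ∀ e, ends' (ιE e) = ends e) (p : E → R) (s x : V) (𝓤 𝓥 : Set (Set V)) :
    tForm ends' (extP ιE p) s x 𝓤 𝓥 = tForm ends p s x 𝓤 𝓥 := by
  unfold tForm
  simp only [prob_extP, Set.preimage_inter, preimage_clusterInEvent ιE ends ends' h]

/-- **The form is invariant under a vertex extension** (families lifted along the injection). -/
theorem tForm_mapV (ιV : V ↪ V') (ends : E → Sym2 V) (p : E → R) (s x : V)
    (𝓤 𝓥 : Set (Set V)) :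
    tForm (mapEnds ιV ends) p (ιV s) (ιV x) (liftFam ιV 𝓤) (liftFam ιV 𝓥) =
      tForm ends p s x 𝓤 𝓥 := by
  unfold tForm
  rw [← liftFam_hit ιV x]
  simp only [clusterInEvent_map]

/-- **The form is invariant under subgraph embeddings**: `ιV : V ↪ V'`, `ιE : E ↪ E'` with
`ends' (ιE e) = (ends e).map ιV`, the new edges at weight `0`, the families lifted. -/
theorem tForm_extend (ιV : V ↪ V') (ιE : E ↪ E') (ends : E → Sym2 V) (ends' : E' → Sym2 V')
    (h : ∀ e, ends' (ιE e) = (ends e).map ιV) (p : E → R) (s x : V) (𝓤 𝓥 : Set (Set V)) :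
    tForm ends' (extP ιE p) (ιV s) (ιV x) (liftFam ιV 𝓤) (liftFam ιV 𝓥) =
      tForm ends p s x 𝓤 𝓥 := by
  rw [tForm_extE ιE (mapEnds ιV ends) ends' h, tForm_mapV]

end Form

section Refutation

open THRefutation

/-- The witness of `THRefutation` as a value of `tForm`: negative. -/
lemma tForm_witness_neg :
    tForm ends p 0 1 {T : Set (Fin 7) | (5 : Fin 7) ∈ T} {T : Set (Fin 7) | (6 : Fin 7) ∈ T} < 0 := by
  have h := t_form_neg
  simp only at h
  unfold tForm
  linarith

/-- **`(T_h)` fails on every finite graph containing the 7-vertex graph `G₆` of `THRefutation` as a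
subgraph** (vertex injection `ιV`, edge injection `ιE` with `ends' (ιE e) = (ends e).map ιV`; any further
vertices and edges): with the weights of `THRefutation` on the image edges and `0` elsewhere, and the
lifted single-vertex families, `P(Q ∩ U ∩ e) + P(Q) P(U ∩ e) < P(Q ∩ U) P(e) + P(Q ∩ e) P(U)`. -/
theorem not_t_of_subgraph {V' E' : Type*} [Fintype E'] [DecidableEq E'] (ιV : Fin 7 ↪ V')
    (ιE : Fin 10 ↪ E') (ends' : E' → Sym2 V') (h : ∀ e, ends' (ιE e) = (ends e).map ιV) :
    let Q := clusterInEvent ends' (ιV 0) {T : Set V' | ιV 1 ∈ T}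
    let U := clusterInEvent ends' (ιV 0) (liftFam ιV {T : Set (Fin 7) | (5 : Fin 7) ∈ T})
    let e := clusterInEvent ends' (ιV 0) (liftFam ιV {T : Set (Fin 7) | (6 : Fin 7) ∈ T})
    prob (extP ιE p) (Q ∩ U ∩ e) + prob (extP ιE p) Q * prob (extP ιE p) (U ∩ e) <
      prob (extP ιE p) (Q ∩ U) * prob (extP ιE p) e + prob (extP ιE p) (Q ∩ e) * prob (extP ιE p) U := by
  intro Q U e
  have key := tForm_extend ιV ιE ends ends' h p 0 1 {T : Set (Fin 7) | (5 : Fin 7) ∈ T}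
    {T : Set (Fin 7) | (6 : Fin 7) ∈ T}
  have hneg := tForm_witness_neg
  rw [← key] at hneg
  unfold tForm at hneg
  linarith

/-- The supergraph statement in existential form: on every finite graph containing `G₆` there are
admissible weights and up-sets `𝓤 𝓥` violating `(T_h)`. -/
theorem exists_violation_of_subgraph {V' E' : Type*} [Fintype E'] [DecidableEq E']
    (ιV : Fin 7 ↪ V') (ιE : Fin 10 ↪ E') (ends' : E' → Sym2 V')
    (h : ∀ e, ends' (ιE e) = (ends e).map ιV) :
    ∃ (p' : E' → ℚ) (𝓤 𝓥 : Set (Set V')), IsProbVec p' ∧ IsUpperSet 𝓤 ∧ IsUpperSet 𝓥 ∧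
      prob p' (clusterInEvent ends' (ιV 0) {T : Set V' | ιV 1 ∈ T} ∩ clusterInEvent ends' (ιV 0) 𝓤 ∩
          clusterInEvent ends' (ιV 0) 𝓥)
        + prob p' (clusterInEvent ends' (ιV 0) {T : Set V' | ιV 1 ∈ T}) *
          prob p' (clusterInEvent ends' (ιV 0) 𝓤 ∩ clusterInEvent ends' (ιV 0) 𝓥) <
      prob p' (clusterInEvent ends' (ιV 0) {T : Set V' | ιV 1 ∈ T} ∩ clusterInEvent ends' (ιV 0) 𝓤) *
          prob p' (clusterInEvent ends' (ιV 0) 𝓥)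
        + prob p' (clusterInEvent ends' (ιV 0) {T : Set V' | ιV 1 ∈ T} ∩
            clusterInEvent ends' (ιV 0) 𝓥) * prob p' (clusterInEvent ends' (ιV 0) 𝓤) :=
  ⟨extP ιE p, liftFam ιV {T : Set (Fin 7) | (5 : Fin 7) ∈ T},
    liftFam ιV {T : Set (Fin 7) | (6 : Fin 7) ∈ T}, isProbVec_extP ιE isProbVec_p,
    isUpperSet_liftFam ιV (fun _ _ hle hT => hle hT), isUpperSet_liftFam ιV (fun _ _ hle hT => hle hT),
    not_t_of_subgraph ιV ιE ends' h⟩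

end Refutation

end THExtension

end Summit.Ventures.PercRepro2
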